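import Literature.NumberTheory.ConnesConsani2021.SpectralCertSound
import Literature.Analysis.OperatorTheory.HermitianKernelOperator
import HarnessLib

/-!
# Connes–Consani 2021 §6, the spectral certificate — SOUNDNESS LEMMAS II: the Hilbert–Schmidt
# bound and the expansion of the residual (generic, no numerics)

LABEL (line 1): RH-FREE.  Generic measure theory / functional analysis: the operator norm of an
integral operator with bounded kernel on `L²` of a finite measure space is at most the `L²` norm of
its kernel (Hilbert–Schmidt bound), applied to the difference of the operator `windowOp κ` of
Connes–Consani's (opkf) and a finite-rank Galerkin approximant; and the expansion of the resulting
double integral into finitely many scalar quantities.  Nothing here mentions `ζ`, its zeros, or RH;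
nothing here bears on the truth of RH.  No number of Connes–Consani's §6 enters (A. Connes,
C. Consani, *Weil positivity and trace formula, the archimedean place*, Selecta Math. (N.S.) 27
(2021) 77 = arXiv:2006.13771, §6 pp. 22–29 [bib: `ConnesConsani2021`]; Thm. 3.6 p. 13: "the function
`K̃_I(v, u)` is square integrable and hence the operator `K_I` is of Hilbert–Schmidt class"; Lemma 6.3
§6.4 p. 24: an operator-norm bound `‖𝐊_I − T‖ ≤ ε₁` for a finite-rank approximant `T` of `𝐊_I` from an
estimate on kernels).

## Role (cell `rh-crit`, sub-cell cc, `cc/ENGINE-SPEC-C.md` §2 "Lean side", row C-SOUND, part 2/2)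

Sequel of `SpectralCertSound.lean` (part 1: (S2) compression gap, finite-rank operators
`finRankOp p t = Σ t_ij |p_i⟩⟨p_j|` and their coordinates, real-data reduction `certQuadForm`,
(S3) the Legendre window family).  Here:

* **(S1) generic Hilbert–Schmidt bound** (`RCLike` scalars, finite measure `μ` on `X`, kernel
  `D : X → X → 𝕜` strongly measurable and bounded): `‖∫ D(x, y) φ(y) dμ(y)‖² ≤ (∫ ‖D(x, ·)‖²) ‖φ‖²`
  (row-wise Cauchy–Schwarz, `norm_integral_kernel_mul_sq_le`), hence for ANY bounded operator `A` on
  `L²(X, μ)` whose matrix coefficients are given by the kernel,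
  `⟪ψ, Aφ⟫ = ∫ conj ψ(x) ∫ D(x, y) φ(y)`, the bound `‖A‖ ≤ (∫∫ ‖D‖²)^{1/2}`
  (`opNorm_le_sqrt_of_inner_eq_integral`);
* the finite-rank operator `finRankOp p t` on vectors `p_i ∈ L²` with bounded measurable
  representatives `F_i` IS such an operator, with kernel `Σ_ij t_ij F_i(x) conj F_j(y)`
  (`inner_finRankOp_eq_integral`), so `‖A − finRankOp p t‖ ≤ (∫∫ ‖D − Σ t_ij F_i ⊗ conj F_j‖²)^{1/2}`
  (`opNorm_sub_finRankOp_le`);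
* **(S4) the expansion of the residual**:
  `∫∫ ‖D(x,y) − Σ t_ij F_i(x) conj F_j(y)‖² = ∫∫‖D‖² − 2 re Σ_ij conj(t_ij) M_ij
     + re Σ_ijkl conj(t_ij) t_kl Γ_ik Γ_lj`,
  `M_ij = ∫ conj F_i(x) ∫ D(x, y) F_j(y) = ⟪p_i, A p_j⟫`, `Γ_ik = ∫ conj F_i F_k = ⟪p_i, p_k⟫`
  (`integral_integral_norm_sub_finRank_sq`, `…_eq_inner`) — computed in the Hilbert space
  `L²(μ ⊗ μ)`, where the finite-rank kernel is the vector `Σ t_ij F_i ⊗ conj F_j`;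
* **the window instance**: for continuous `κ` and continuous representatives `F_i` of `p_i ∈ 𝓗 =
  L²([a, b])`, `‖windowOp κ − finRankOp p t‖ ≤ (∫_I∫_I ‖κ(y − x) − Σ t_ij F_i(y) conj F_j(x)‖² dx dy)^{1/2}`
  (`norm_windowOp_sub_finRankOp_le`, from the Schwartz-kernel form
  `WindowOperatorCompact.inner_windowOp_eq_integral_integral`), the matrix coefficients
  `⟪p_i, windowOp κ p_j⟫` of the Legendre window family as explicit double integrals, the expansion
  (S4) for the Legendre family (diagonal Gram matrix), and the **assembled soundness theorem**
  `targetIneq_of_legendreCertificate`: a real PSD certificate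
  `∀ x, 0 ≤ certQuadForm (legendreGram (b−a) N) t (constCoords (b−a) N) a₀ μ x`, a residual bound
  `∫_I∫_I ‖κ(y−x) − Σ t_ij p_i(y) p_j(x)‖² ≤ δ²` and `0 ≤ δ ≤ min(1, μ)` give
  `∀ ξ, 0 ≤ re⟪ξ, ξ − windowOp κ ξ⟫ + a₀ ‖⟪constVector a b, ξ⟫‖²` — verbatim the hypothesis `hpos`
  of `MainInequalityAssembly.weilArchPositivity_soninTrace_fine_of_opIneq` once `κ = ϖ_G`,
  `[a, b] = [−½ log 2, ½ log 2]`.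

Follow-up (same file): `integral_Icc_integral_Icc_comp_sub` / `hsNormSq_windowKernel_eq` — the
analytic input `H = ∫_I∫_I ‖κ(y − x)‖²` as the single integral `∫_{a−b}^{b−a} ((b − a) − |v|) ‖κ(v)‖² dv`
(FTC and integration by parts), and `inner_legendreWindowVec_windowOp_symm` — for an EVEN kernel the
matrix `M_ij` of the Legendre family is symmetric (Fubini), so only `i ≤ j` need enclosing.

No definition, no named fact, no instance; every statement proved.  Tree inputs: the bounded-kernel
package `Literature.Analysis.OperatorTheory.IntegralOperatorHilbertSchmidt` /
`HermitianKernelOperator` (Bump 1997 Thm. 2.3.2; Reed–Simon I Thm. VI.23), part 1 of this file pair,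
`WindowOperatorCompact`.  [RH-FREE; bears on the cell's bookkeeping (W-C/W-P) only through the
consumer `hpos`; WHAT THIS IS NOT: any statement about `ζ`, and no numerical input of §6.]
-/

noncomputable section

open MeasureTheory Set Complex Filter Function
open scoped ComplexConjugate InnerProductSpace

namespace Literature.NumberTheory.ConnesConsani2021

namespace SpectralCert

open Literature.Analysis.OperatorTheory

/-! ## Toolkit: bounded measurable functions on a finite measure space -/

section Toolkit

variable {Y : Type*} [MeasurableSpace Y] {ν : Measure Y} [IsFiniteMeasure ν]
variable {E' : Type*} [NormedAddCommGroup E']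

/-- Bounded and a.e.-strongly measurable on a finite measure space ⇒ integrable. [folklore] -/
private theorem integrable_of_norm_le {f : Y → E'} (hf : AEStronglyMeasurable f ν) {M : ℝ}
    (hM : ∀ y, ‖f y‖ ≤ M) : Integrable f ν :=
  memLp_one_iff_integrable.1 (MemLp.of_bound hf M (Eventually.of_forall hM))

omit [IsFiniteMeasure ν] in
/-- `‖f‖²_{L²} = ∫ ‖f‖²` for `f ∈ L²`. [folklore] -/
private theorem norm_Lp_two_sq_eq_integral {𝕜 : Type*} [RCLike 𝕜] (f : Lp 𝕜 2 ν) :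
    ‖f‖ ^ 2 = ∫ y, ‖f y‖ ^ 2 ∂ν := by
  have h := norm_toLp_sq_eq_integral_norm_sq (Lp.memLp f)
  rwa [Lp.toLp_coeFn] at h

end Toolkit

/-! ## (S1) The Hilbert–Schmidt bound for an integral operator with bounded kernel -/

section HilbertSchmidt

variable {𝕜 : Type*} [RCLike 𝕜] {X : Type*} [MeasurableSpace X] {μ : Measure X} [IsFiniteMeasure μ]
variable {D : X → X → 𝕜} {C : ℝ}

/-- RH-FREE. **Row-wise Cauchy–Schwarz**: `‖∫ D(x, y) φ(y) dμ(y)‖² ≤ (∫ ‖D(x, y)‖² dμ(y)) · ‖φ‖²_{L²}`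
for a bounded strongly measurable kernel on a finite measure space (`(T_D φ)(x) = ⟪conj D(x, ·), φ⟫`,
tree `integral_kernel_mul_eq_inner`).
[cite: ConnesConsani2021, Thm. 3.6 §3 p. 13 ("square integrable … hence … Hilbert–Schmidt class"); Bump1997, Ch. 2 §2.3 Thm. 2.3.2 (proof)] -/
theorem norm_integral_kernel_mul_sq_le (hD : StronglyMeasurable (uncurry D))
    (hC : ∀ x y, ‖D x y‖ ≤ C) (φ : Lp 𝕜 2 μ) (x : X) :
    ‖∫ y, D x y * φ y ∂μ‖ ^ 2 ≤ (∫ y, ‖D x y‖ ^ 2 ∂μ) * ‖φ‖ ^ 2 := by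
  rw [integral_kernel_mul_eq_inner hD hC x φ]
  have h1 := norm_inner_le_norm (𝕜 := 𝕜) ((memLp_two_conj_kernel_section hD hC x).toLp _) φ
  have h2 : ‖(memLp_two_conj_kernel_section (μ := μ) hD hC x).toLp _‖ ^ 2 = ∫ y, ‖D x y‖ ^ 2 ∂μ := by
    rw [norm_toLp_sq_eq_integral_norm_sq]
    simp only [RCLike.norm_conj]
  rw [← h2, ← mul_pow]
  exact pow_le_pow_left₀ (norm_nonneg _) h1 2

/-- `x ↦ ∫ ‖D(x, y)‖² dμ(y)` is integrable (bounded by `C² μ(X)`). [folklore] -/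
private theorem integrable_integral_norm_kernel_sq (hD : StronglyMeasurable (uncurry D))
    (hC : ∀ x y, ‖D x y‖ ≤ C) : Integrable (fun x ↦ ∫ y, ‖D x y‖ ^ 2 ∂μ) μ := by
  refine integrable_of_norm_le (stronglyMeasurable_integral_norm_kernel_sq hD).aestronglyMeasurable
    (M := C ^ 2 * μ.real univ) fun x ↦ ?_
  rw [Real.norm_of_nonneg (integral_nonneg fun y ↦ by positivity)]
  have h1 : ‖∫ y, ‖D x y‖ ^ 2 ∂μ‖ ≤ C ^ 2 * μ.real univ :=
    norm_integral_le_of_norm_le_const (Eventually.of_forall fun y ↦ by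
      rw [Real.norm_of_nonneg (by positivity)]
      exact pow_le_pow_left₀ (norm_nonneg _) (hC x y) 2)
  exact (Real.le_norm_self _).trans h1

/-- RH-FREE. **The Hilbert–Schmidt bound, integrated form**:
`∫ ‖∫ D(x, y) φ(y) dμ(y)‖² dμ(x) ≤ (∫∫ ‖D‖²) · ‖φ‖²`.
[cite: ConnesConsani2021, Thm. 3.6 §3 p. 13; Bump1997, Ch. 2 §2.3 Thm. 2.3.2 eq. (3.3)] -/
theorem integral_norm_integral_kernel_mul_sq_le (hD : StronglyMeasurable (uncurry D))
    (hC : ∀ x y, ‖D x y‖ ≤ C) (φ : Lp 𝕜 2 μ) :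
    ∫ x, ‖∫ y, D x y * φ y ∂μ‖ ^ 2 ∂μ ≤ (∫ x, ∫ y, ‖D x y‖ ^ 2 ∂μ ∂μ) * ‖φ‖ ^ 2 := by
  rw [← integral_mul_const]
  exact integral_mono_of_nonneg (Eventually.of_forall fun x ↦ by positivity)
    ((integrable_integral_norm_kernel_sq hD hC).mul_const _)
    (Eventually.of_forall fun x ↦ norm_integral_kernel_mul_sq_le hD hC φ x)

/-- RH-FREE. **Operator norm ≤ Hilbert–Schmidt norm of the kernel.**  If a bounded operator `A` on
`L²(X, μ)` (finite measure) has matrix coefficients `⟪ψ, Aφ⟫ = ∫ conj ψ(x) (∫ D(x, y) φ(y) dμ(y)) dμ(x)`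
for a bounded strongly measurable kernel `D`, then `‖A‖ ≤ (∫∫ ‖D(x, y)‖² dμ dμ)^{1/2}` (indeed
`Aφ` is the class of `x ↦ ∫ D(x, y) φ(y)`).  The step "`‖𝐊_I − T‖ ≤ ‖𝐊_I − T‖_{HS}`" of the
certificate. [cite: ConnesConsani2021, Thm. 3.6 §3 p. 13; Lemma 6.3 §6.4 p. 24 (norm bound for `𝐊_I − T`, pattern); ReedSimonI1980, Thm VI.23] -/
theorem opNorm_le_sqrt_of_inner_eq_integral (hD : StronglyMeasurable (uncurry D))
    (hC : ∀ x y, ‖D x y‖ ≤ C) (A : Lp 𝕜 2 μ →L[𝕜] Lp 𝕜 2 μ)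
    (hA : ∀ φ ψ : Lp 𝕜 2 μ, ⟪ψ, A φ⟫_𝕜 = ∫ x, conj (ψ x) * ∫ y, D x y * φ y ∂μ ∂μ) :
    ‖A‖ ≤ Real.sqrt (∫ x, ∫ y, ‖D x y‖ ^ 2 ∂μ ∂μ) := by
  refine ContinuousLinearMap.opNorm_le_bound _ (Real.sqrt_nonneg _) fun φ ↦ ?_
  have hmem := memLp_two_integral_kernel_mul hD hC φ
  have hAφ : A φ = hmem.toLp _ := by
    refine ext_inner_left 𝕜 fun ψ ↦ ?_
    rw [hA, L2.inner_def]
    refine integral_congr_ae ?_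
    filter_upwards [hmem.coeFn_toLp] with x hx
    rw [hx, RCLike.inner_apply']
  have h0 : 0 ≤ ∫ x, ∫ y, ‖D x y‖ ^ 2 ∂μ ∂μ :=
    integral_nonneg fun x ↦ integral_nonneg fun y ↦ by positivity
  have h1 : ‖A φ‖ ^ 2 ≤ (Real.sqrt (∫ x, ∫ y, ‖D x y‖ ^ 2 ∂μ ∂μ) * ‖φ‖) ^ 2 := by
    rw [hAφ, norm_toLp_sq_eq_integral_norm_sq, mul_pow, Real.sq_sqrt h0]
    exact integral_norm_integral_kernel_mul_sq_le hD hC φ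
  exact (pow_le_pow_iff_left₀ (norm_nonneg _) (by positivity) two_ne_zero).1 h1

/-- `x ↦ conj ψ(x) ∫ D(x, y) φ(y) dμ(y)` is integrable (Fubini on the tree's
`integrable_conj_mul_kernel_mul_coeFn`). [folklore] -/
private theorem integrable_conj_mul_integral (hD : StronglyMeasurable (uncurry D))
    (hC : ∀ x y, ‖D x y‖ ≤ C) (φ ψ : Lp 𝕜 2 μ) :
    Integrable (fun x ↦ conj (ψ x) * ∫ y, D x y * φ y ∂μ) μ := by
  refine ((integrable_conj_mul_kernel_mul_coeFn hD hC ψ φ).integral_prod_left).congr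
    (Eventually.of_forall fun x ↦ ?_)
  dsimp only
  exact integral_const_mul (conj ((ψ : X → 𝕜) x)) fun y ↦ D x y * φ y

/-- RH-FREE. Kernel forms are linear in the kernel: the form of `D₁ − D₂` is the difference of the
forms. [cite: ConnesConsani2021, Lemma 6.3 §6.4 p. 24 (the operator `𝐊_I − T`, pattern)] -/
theorem integral_conj_mul_integral_sub_kernel {D₁ D₂ : X → X → 𝕜} {C₁ C₂ : ℝ}
    (hD₁ : StronglyMeasurable (uncurry D₁)) (hC₁ : ∀ x y, ‖D₁ x y‖ ≤ C₁)
    (hD₂ : StronglyMeasurable (uncurry D₂)) (hC₂ : ∀ x y, ‖D₂ x y‖ ≤ C₂) (φ ψ : Lp 𝕜 2 μ) :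
    ∫ x, conj (ψ x) * ∫ y, (D₁ x y - D₂ x y) * φ y ∂μ ∂μ
      = (∫ x, conj (ψ x) * ∫ y, D₁ x y * φ y ∂μ ∂μ)
          - ∫ x, conj (ψ x) * ∫ y, D₂ x y * φ y ∂μ ∂μ := by
  rw [← integral_sub (integrable_conj_mul_integral hD₁ hC₁ φ ψ)
    (integrable_conj_mul_integral hD₂ hC₂ φ ψ)]
  refine integral_congr_ae (Eventually.of_forall fun x ↦ ?_)
  dsimp only
  rw [← mul_sub, ← integral_sub (integrable_kernel_mul_coeFn_rclike hD₁ hC₁ φ x)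
    (integrable_kernel_mul_coeFn_rclike hD₂ hC₂ φ x)]
  congr 1
  refine integral_congr_ae (Eventually.of_forall fun y ↦ ?_)
  simp only [sub_mul]

end HilbertSchmidt

/-! ## Finite-rank operators on `L²` as integral operators -/

section FiniteRankKernel

variable {𝕜 : Type*} [RCLike 𝕜] {X : Type*} [MeasurableSpace X] {μ : Measure X} [IsFiniteMeasure μ]
variable {ι : Type*} [Fintype ι]

omit [IsFiniteMeasure μ] in
/-- The finite-rank kernel `(x, y) ↦ Σ_ij t_ij F_i(x) conj F_j(y)` is measurable. [folklore] -/
private theorem measurable_finRankKernel (F : ι → X → 𝕜) (hFm : ∀ i, Measurable (F i))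
    (t : Matrix ι ι 𝕜) :
    Measurable (fun z : X × X ↦ ∑ i, ∑ j, t i j * (F i z.1 * conj (F j z.2))) := by
  refine Finset.measurable_sum _ fun i _ ↦ Finset.measurable_sum _ fun j _ ↦ ?_
  exact (((hFm i).comp measurable_fst).mul
    (RCLike.continuous_conj.measurable.comp ((hFm j).comp measurable_snd))).const_mul _

omit [MeasurableSpace X] [IsFiniteMeasure μ] in
/-- The finite-rank kernel is bounded by `Σ_ij ‖t_ij‖ B²`. [folklore] -/
private theorem norm_finRankKernel_le (F : ι → X → 𝕜) {B : ℝ} (hFb : ∀ i x, ‖F i x‖ ≤ B)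
    (t : Matrix ι ι 𝕜) (x y : X) :
    ‖∑ i, ∑ j, t i j * (F i x * conj (F j y))‖ ≤ ∑ i, ∑ j, ‖t i j‖ * (B * B) := by
  refine (norm_sum_le _ _).trans (Finset.sum_le_sum fun i _ ↦
    (norm_sum_le _ _).trans (Finset.sum_le_sum fun j _ ↦ ?_))
  rw [norm_mul, norm_mul, RCLike.norm_conj]
  have hB : 0 ≤ B := (norm_nonneg _).trans (hFb i x)
  exact mul_le_mul_of_nonneg_left (mul_le_mul (hFb i x) (hFb j y) (norm_nonneg _) hB)
    (norm_nonneg _)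

omit [Fintype ι] in
/-- `conj F_j · φ` is integrable for bounded measurable `F_j` and `φ ∈ L²`. [folklore] -/
private theorem integrable_conj_rep_mul (F : ι → X → 𝕜) (hFm : ∀ i, Measurable (F i)) {B : ℝ}
    (hFb : ∀ i x, ‖F i x‖ ≤ B) (φ : Lp 𝕜 2 μ) (j : ι) :
    Integrable (fun y ↦ conj (F j y) * φ y) μ :=
  ((Lp.memLp φ).integrable one_le_two).bdd_mul
    (RCLike.continuous_conj.measurable.comp (hFm j)).aestronglyMeasurable
    (Eventually.of_forall fun y ↦ by rw [RCLike.norm_conj]; exact hFb j y)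

omit [Fintype ι] in
/-- `conj ψ · F_i` is integrable for bounded measurable `F_i` and `ψ ∈ L²`. [folklore] -/
private theorem integrable_conj_mul_rep (F : ι → X → 𝕜) (hFm : ∀ i, Measurable (F i)) {B : ℝ}
    (hFb : ∀ i x, ‖F i x‖ ≤ B) (ψ : Lp 𝕜 2 μ) (i : ι) :
    Integrable (fun x ↦ conj (ψ x) * F i x) μ := by
  have hψ : Integrable (fun x ↦ conj ((ψ : X → 𝕜) x)) μ :=
    ((Lp.memLp ψ).integrable one_le_two).mono
      (RCLike.continuous_conj.comp_aestronglyMeasurable (Lp.aestronglyMeasurable ψ))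
      (Eventually.of_forall fun x ↦ by rw [RCLike.norm_conj])
  exact hψ.mul_bdd (hFm i).aestronglyMeasurable (Eventually.of_forall fun x ↦ hFb i x)

/-- RH-FREE. **A finite-rank operator on `L²` is an integral operator.**  For `p_i ∈ L²(X, μ)` with
bounded measurable representatives `F_i` (`p_i = F_i` a.e.), the operator
`finRankOp p t = Σ_ij t_ij |p_i⟩⟨p_j|` has the kernel form
`⟪ψ, finRankOp p t φ⟫ = ∫ conj ψ(x) ∫ (Σ_ij t_ij F_i(x) conj F_j(y)) φ(y) dμ(y) dμ(x)`.
[cite: ConnesConsani2021, §6.4 eq. (opT) p. 24 (finite-rank approximant of `𝐊_I`, pattern)] -/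
theorem inner_finRankOp_eq_integral (p : ι → Lp 𝕜 2 μ) (F : ι → X → 𝕜)
    (hFm : ∀ i, Measurable (F i)) {B : ℝ} (hFb : ∀ i x, ‖F i x‖ ≤ B)
    (hp : ∀ i, (p i : X → 𝕜) =ᵐ[μ] F i) (t : Matrix ι ι 𝕜) (φ ψ : Lp 𝕜 2 μ) :
    ⟪ψ, finRankOp p t φ⟫_𝕜
      = ∫ x, conj (ψ x) * ∫ y, (∑ i, ∑ j, t i j * (F i x * conj (F j y))) * φ y ∂μ ∂μ := by
  have hc : ∀ j, ∫ y, conj (F j y) * φ y ∂μ = ⟪p j, φ⟫_𝕜 := by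
    intro j
    rw [L2.inner_def]
    refine integral_congr_ae ?_
    filter_upwards [hp j] with y hy
    rw [RCLike.inner_apply', hy]
  have hd : ∀ i, ∫ x, conj (ψ x) * F i x ∂μ = ⟪ψ, p i⟫_𝕜 := by
    intro i
    rw [L2.inner_def]
    refine integral_congr_ae ?_
    filter_upwards [hp i] with x hx
    rw [RCLike.inner_apply', hx]
  have hFφ := integrable_conj_rep_mul (μ := μ) F hFm hFb φ
  have hψF := integrable_conj_mul_rep (μ := μ) F hFm hFb ψ
  -- the inner integral, pointwise in `x`
  have hinner : ∀ x, ∫ y, (∑ i, ∑ j, t i j * (F i x * conj (F j y))) * φ y ∂μ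
      = ∑ i, ∑ j, t i j * F i x * ⟪p j, φ⟫_𝕜 := by
    intro x
    have e : (fun y ↦ (∑ i, ∑ j, t i j * (F i x * conj (F j y))) * φ y)
        = fun y ↦ ∑ i, ∑ j, (t i j * F i x) * (conj (F j y) * φ y) := by
      funext y
      rw [Finset.sum_mul]
      refine Finset.sum_congr rfl fun i _ ↦ ?_
      rw [Finset.sum_mul]
      refine Finset.sum_congr rfl fun j _ ↦ ?_
      ring
    rw [e, integral_finsetSum _ fun i _ ↦
      integrable_finsetSum _ fun j _ ↦ (hFφ j).const_mul _]
    refine Finset.sum_congr rfl fun i _ ↦ ?_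
    rw [integral_finsetSum _ fun j _ ↦ (hFφ j).const_mul _]
    refine Finset.sum_congr rfl fun j _ ↦ ?_
    rw [integral_const_mul, hc]
  simp_rw [hinner]
  -- the outer integral
  have e : (fun x ↦ conj (ψ x) * ∑ i, ∑ j, t i j * F i x * ⟪p j, φ⟫_𝕜)
      = fun x ↦ ∑ i, ∑ j, (t i j * ⟪p j, φ⟫_𝕜) * (conj (ψ x) * F i x) := by
    funext x
    rw [Finset.mul_sum]
    refine Finset.sum_congr rfl fun i _ ↦ ?_
    rw [Finset.mul_sum]
    refine Finset.sum_congr rfl fun j _ ↦ ?_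
    ring
  rw [inner_finRankOp, e, integral_finsetSum _ fun i _ ↦
    integrable_finsetSum _ fun j _ ↦ (hψF i).const_mul _]
  refine Finset.sum_congr rfl fun i _ ↦ ?_
  rw [integral_finsetSum _ fun j _ ↦ (hψF i).const_mul _]
  refine Finset.sum_congr rfl fun j _ ↦ ?_
  rw [integral_const_mul, hd]
  ring

/-- RH-FREE. **`‖A − T‖ ≤ ‖D − Σ t_ij F_i ⊗ conj F_j‖_{L²(μ⊗μ)}`**: for a bounded operator `A` with
bounded measurable kernel `D` (in the sense of matrix coefficients) and the finite-rank operator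
`T = finRankOp p t` on vectors with bounded measurable representatives `F_i`,
`‖A − T‖ ≤ (∫∫ ‖D(x, y) − Σ_ij t_ij F_i(x) conj F_j(y)‖² dμ(y) dμ(x))^{1/2}`.
[cite: ConnesConsani2021, Lemma 6.3 §6.4 p. 24 (bound for `‖𝐊_I − T‖`, pattern); Thm. 3.6 §3 p. 13 (Hilbert–Schmidt)] -/
theorem opNorm_sub_finRankOp_le {D : X → X → 𝕜} {C : ℝ} (hD : StronglyMeasurable (uncurry D))
    (hC : ∀ x y, ‖D x y‖ ≤ C) (A : Lp 𝕜 2 μ →L[𝕜] Lp 𝕜 2 μ)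
    (hA : ∀ φ ψ : Lp 𝕜 2 μ, ⟪ψ, A φ⟫_𝕜 = ∫ x, conj (ψ x) * ∫ y, D x y * φ y ∂μ ∂μ)
    (p : ι → Lp 𝕜 2 μ) (F : ι → X → 𝕜) (hFm : ∀ i, Measurable (F i)) {B : ℝ}
    (hFb : ∀ i x, ‖F i x‖ ≤ B) (hp : ∀ i, (p i : X → 𝕜) =ᵐ[μ] F i) (t : Matrix ι ι 𝕜) :
    ‖A - finRankOp p t‖
      ≤ Real.sqrt (∫ x, ∫ y, ‖D x y - ∑ i, ∑ j, t i j * (F i x * conj (F j y))‖ ^ 2 ∂μ ∂μ) := by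
  have hSm : StronglyMeasurable (uncurry fun x y ↦ ∑ i, ∑ j, t i j * (F i x * conj (F j y))) :=
    (measurable_finRankKernel F hFm t).stronglyMeasurable
  have hSb := norm_finRankKernel_le F hFb t
  refine opNorm_le_sqrt_of_inner_eq_integral
    (D := fun x y ↦ D x y - ∑ i, ∑ j, t i j * (F i x * conj (F j y))) (hD.sub hSm)
    (C := C + ∑ i, ∑ j, ‖t i j‖ * (B * B))
    (fun x y ↦ (norm_sub_le _ _).trans (add_le_add (hC x y) (hSb x y))) _ fun φ ψ ↦ ?_
  rw [show (A - finRankOp p t) φ = A φ - finRankOp p t φ from rfl, inner_sub_right, hA,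
    inner_finRankOp_eq_integral p F hFm hFb hp, integral_conj_mul_integral_sub_kernel hD hC hSm hSb]

/-- The a.e. representative of `Σ_ij t_ij • e_ij` in `L²`. [folklore] -/
private theorem coeFn_sum_sum_smul {Y : Type*} [MeasurableSpace Y] {ν : Measure Y}
    (t : Matrix ι ι 𝕜) (e : ι → ι → Lp 𝕜 2 ν) (G : ι → ι → Y → 𝕜)
    (he : ∀ i j, (e i j : Y → 𝕜) =ᵐ[ν] G i j) :
    ((∑ i, ∑ j, t i j • e i j : Lp 𝕜 2 ν) : Y → 𝕜) =ᵐ[ν] fun z ↦ ∑ i, ∑ j, t i j * G i j z := by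
  have h1 : ∀ i, ((∑ j, t i j • e i j : Lp 𝕜 2 ν) : Y → 𝕜) =ᵐ[ν] fun z ↦ ∑ j, t i j * G i j z := by
    intro i
    filter_upwards [Lp.coeFn_fun_finsetSum Finset.univ (fun j ↦ t i j • e i j),
      eventually_all.2 fun j ↦ Lp.coeFn_smul (t i j) (e i j), eventually_all.2 (he i)]
      with z hz h1 h2
    rw [hz]
    exact Finset.sum_congr rfl fun j _ ↦ by rw [h1 j, Pi.smul_apply, h2 j, smul_eq_mul]
  filter_upwards [Lp.coeFn_fun_finsetSum Finset.univ (fun i ↦ ∑ j, t i j • e i j),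
    eventually_all.2 h1] with z hz h1z
  rw [hz]
  exact Finset.sum_congr rfl fun i _ ↦ h1z i

/-- RH-FREE. **(S4) Expansion of the Hilbert–Schmidt residual.**  For a bounded strongly measurable
kernel `D` and bounded measurable `F_i` on a finite measure space,
`∫∫ ‖D(x, y) − Σ_ij t_ij F_i(x) conj F_j(y)‖² = ∫∫ ‖D‖² − 2 re Σ_ij conj(t_ij) M_ij + re Σ_ijkl conj(t_ij) t_kl Γ_ik Γ_lj`
with `M_ij = ∫ conj F_i(x) (∫ D(x, y) F_j(y) dμ(y)) dμ(x)` and `Γ_ik = ∫ conj F_i F_k dμ` — the norm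
identity `‖k − s‖² = ‖k‖² − 2 re⟪s, k⟫ + ‖s‖²` in `L²(μ ⊗ μ)` for `k = D`, `s = Σ t_ij F_i ⊗ conj F_j`.
(The display (d) of the certificate: "every quantity is one of the finitely many analytic inputs
`M_ij`, `H`, or Gram data".) [cite: ConnesConsani2021, Lemma 6.3 §6.4 p. 24 and Fact 6.1 (the residual `ε₁` of a finite-rank approximant, pattern)] -/
theorem integral_integral_norm_sub_finRank_sq {D : X → X → 𝕜} {C : ℝ}
    (hD : StronglyMeasurable (uncurry D)) (hC : ∀ x y, ‖D x y‖ ≤ C)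
    (F : ι → X → 𝕜) (hFm : ∀ i, Measurable (F i)) {B : ℝ} (hFb : ∀ i x, ‖F i x‖ ≤ B)
    (t : Matrix ι ι 𝕜) :
    ∫ x, ∫ y, ‖D x y - ∑ i, ∑ j, t i j * (F i x * conj (F j y))‖ ^ 2 ∂μ ∂μ
      = (∫ x, ∫ y, ‖D x y‖ ^ 2 ∂μ ∂μ)
        - 2 * RCLike.re (∑ i, ∑ j, conj (t i j) * ∫ x, conj (F i x) * ∫ y, D x y * F j y ∂μ ∂μ)
        + RCLike.re (∑ i, ∑ j, ∑ k, ∑ l, conj (t i j) * t k l *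
            ((∫ x, conj (F i x) * F k x ∂μ) * ∫ y, conj (F l y) * F j y ∂μ)) := by
  -- the finite-rank kernel `S`, measurability and bounds
  set S : X × X → 𝕜 := fun z ↦ ∑ i, ∑ j, t i j * (F i z.1 * conj (F j z.2)) with hS
  have hSm : Measurable S := measurable_finRankKernel F hFm t
  have hSb : ∀ z, ‖S z‖ ≤ ∑ i, ∑ j, ‖t i j‖ * (B * B) := fun z ↦ norm_finRankKernel_le F hFb t z.1 z.2
  have hDm : AEStronglyMeasurable (fun z : X × X ↦ D z.1 z.2) (μ.prod μ) := hD.aestronglyMeasurable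
  -- the vectors `k`, `e i j`, `s` of `L²(μ ⊗ μ)`
  have hDk : MemLp (fun z : X × X ↦ D z.1 z.2) 2 (μ.prod μ) :=
    MemLp.of_bound hDm C (Eventually.of_forall fun z ↦ hC z.1 z.2)
  have hem : ∀ i j, AEStronglyMeasurable (fun z : X × X ↦ F i z.1 * conj (F j z.2)) (μ.prod μ) :=
    fun i j ↦ (((hFm i).comp measurable_fst).mul
      (RCLike.continuous_conj.measurable.comp ((hFm j).comp measurable_snd))).aestronglyMeasurable
  have he : ∀ i j, MemLp (fun z : X × X ↦ F i z.1 * conj (F j z.2)) 2 (μ.prod μ) := fun i j ↦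
    MemLp.of_bound (hem i j) (B * B) (Eventually.of_forall fun z ↦ by
      rw [norm_mul, RCLike.norm_conj]
      exact mul_le_mul (hFb i _) (hFb j _) (norm_nonneg _) ((norm_nonneg _).trans (hFb i z.1)))
  set k : Lp 𝕜 2 (μ.prod μ) := hDk.toLp _ with hk
  set e : ι → ι → Lp 𝕜 2 (μ.prod μ) := fun i j ↦ (he i j).toLp _ with hedef
  have hk_ae : (k : X × X → 𝕜) =ᵐ[μ.prod μ] fun z ↦ D z.1 z.2 := hDk.coeFn_toLp
  have he_ae : ∀ i j, (e i j : X × X → 𝕜) =ᵐ[μ.prod μ] fun z ↦ F i z.1 * conj (F j z.2) :=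
    fun i j ↦ (he i j).coeFn_toLp
  have hs_ae : ((∑ i, ∑ j, t i j • e i j : Lp 𝕜 2 (μ.prod μ)) : X × X → 𝕜) =ᵐ[μ.prod μ] S :=
    coeFn_sum_sum_smul t e _ he_ae
  -- (1) the left-hand side is `‖k − s‖²`
  have hLHS : ‖k - ∑ i, ∑ j, t i j • e i j‖ ^ 2
      = ∫ x, ∫ y, ‖D x y - ∑ i, ∑ j, t i j * (F i x * conj (F j y))‖ ^ 2 ∂μ ∂μ := by
    rw [norm_Lp_two_sq_eq_integral]
    have h1 : (fun z ↦ ‖(k - ∑ i, ∑ j, t i j • e i j) z‖ ^ 2)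
        =ᵐ[μ.prod μ] fun z ↦ ‖D z.1 z.2 - S z‖ ^ 2 := by
      filter_upwards [Lp.coeFn_sub k (∑ i, ∑ j, t i j • e i j), hk_ae, hs_ae] with z hz h1 h2
      rw [hz, Pi.sub_apply, h1, h2]
    rw [integral_congr_ae h1]
    refine integral_prod (fun z : X × X ↦ ‖D z.1 z.2 - S z‖ ^ 2) ?_
    refine integrable_of_norm_le
      ((continuous_pow 2).comp_aestronglyMeasurable (hDm.sub hSm.aestronglyMeasurable).norm)
      (M := (C + ∑ i, ∑ j, ‖t i j‖ * (B * B)) ^ 2) fun z ↦ ?_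
    rw [Real.norm_of_nonneg (by positivity)]
    exact pow_le_pow_left₀ (norm_nonneg _)
      ((norm_sub_le _ _).trans (add_le_add (hC z.1 z.2) (hSb z))) 2
  -- (2) `‖k‖² = ∫∫ ‖D‖²`
  have hk2 : ‖k‖ ^ 2 = ∫ x, ∫ y, ‖D x y‖ ^ 2 ∂μ ∂μ := by
    rw [norm_Lp_two_sq_eq_integral]
    have h1 : (fun z ↦ ‖k z‖ ^ 2) =ᵐ[μ.prod μ] fun z ↦ ‖D z.1 z.2‖ ^ 2 := by
      filter_upwards [hk_ae] with z hz
      rw [hz]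
    rw [integral_congr_ae h1]
    refine integral_prod (fun z : X × X ↦ ‖D z.1 z.2‖ ^ 2) ?_
    refine integrable_of_norm_le ((continuous_pow 2).comp_aestronglyMeasurable hDm.norm)
      (M := C ^ 2) fun z ↦ ?_
    rw [Real.norm_of_nonneg (by positivity)]
    exact pow_le_pow_left₀ (norm_nonneg _) (hC z.1 z.2) 2
  -- (3) `⟪e_ij, k⟫ = M_ij`
  have hek : ∀ i j, ⟪e i j, k⟫_𝕜 = ∫ x, conj (F i x) * ∫ y, D x y * F j y ∂μ ∂μ := by
    intro i j
    rw [L2.inner_def]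
    have h1 : (fun z ↦ ⟪(e i j) z, k z⟫_𝕜)
        =ᵐ[μ.prod μ] fun z ↦ conj (F i z.1) * (D z.1 z.2 * F j z.2) := by
      filter_upwards [he_ae i j, hk_ae] with z h1 h2
      rw [RCLike.inner_apply', h1, h2, map_mul, RCLike.conj_conj]
      ring
    rw [integral_congr_ae h1]
    have hint : Integrable (fun z : X × X ↦ conj (F i z.1) * (D z.1 z.2 * F j z.2)) (μ.prod μ) := by
      refine integrable_of_norm_le
        ((RCLike.continuous_conj.measurable.comp ((hFm i).comp measurable_fst)).aestronglyMeasurable.mul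
          (hDm.mul ((hFm j).comp measurable_snd).aestronglyMeasurable))
        (M := B * (C * B)) fun z ↦ ?_
      rw [norm_mul, norm_mul, RCLike.norm_conj]
      have hB : 0 ≤ B := (norm_nonneg _).trans (hFb i z.1)
      exact mul_le_mul (hFb i _) (mul_le_mul (hC _ _) (hFb j _) (norm_nonneg _)
        ((norm_nonneg _).trans (hC z.1 z.2))) (mul_nonneg (norm_nonneg _) (norm_nonneg _)) hB
    rw [integral_prod _ hint]
    refine integral_congr_ae (Eventually.of_forall fun x ↦ ?_)
    dsimp only
    exact integral_const_mul (conj (F i x)) fun y ↦ D x y * F j y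
  -- (4) `⟪e_ij, e_kl⟫ = Γ_ik Γ_lj`
  have hee : ∀ i j k' l, ⟪e i j, e k' l⟫_𝕜
      = (∫ x, conj (F i x) * F k' x ∂μ) * ∫ y, conj (F l y) * F j y ∂μ := by
    intro i j k' l
    rw [L2.inner_def]
    have h1 : (fun z ↦ ⟪(e i j) z, (e k' l) z⟫_𝕜)
        =ᵐ[μ.prod μ] fun z ↦ (conj (F i z.1) * F k' z.1) * (conj (F l z.2) * F j z.2) := by
      filter_upwards [he_ae i j, he_ae k' l] with z h1 h2
      rw [RCLike.inner_apply', h1, h2, map_mul, RCLike.conj_conj]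
      ring
    rw [integral_congr_ae h1]
    exact integral_prod_mul (fun x ↦ conj (F i x) * F k' x) (fun y ↦ conj (F l y) * F j y)
  -- (5) `⟪s, k⟫` and `⟪s, s⟫`
  have hsk : ⟪(∑ i, ∑ j, t i j • e i j : Lp 𝕜 2 (μ.prod μ)), k⟫_𝕜
      = ∑ i, ∑ j, conj (t i j) * ∫ x, conj (F i x) * ∫ y, D x y * F j y ∂μ ∂μ := by
    rw [sum_inner]
    refine Finset.sum_congr rfl fun i _ ↦ ?_
    rw [sum_inner]
    refine Finset.sum_congr rfl fun j _ ↦ ?_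
    rw [inner_smul_left, hek]
  have hss : ⟪(∑ i, ∑ j, t i j • e i j : Lp 𝕜 2 (μ.prod μ)), ∑ i, ∑ j, t i j • e i j⟫_𝕜
      = ∑ i, ∑ j, ∑ k, ∑ l, conj (t i j) * t k l *
          ((∫ x, conj (F i x) * F k x ∂μ) * ∫ y, conj (F l y) * F j y ∂μ) := by
    rw [sum_inner]
    refine Finset.sum_congr rfl fun i _ ↦ ?_
    rw [sum_inner]
    refine Finset.sum_congr rfl fun j _ ↦ ?_
    rw [inner_smul_left, inner_sum, Finset.mul_sum]
    refine Finset.sum_congr rfl fun k' _ ↦ ?_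
    rw [inner_sum, Finset.mul_sum]
    refine Finset.sum_congr rfl fun l _ ↦ ?_
    rw [inner_smul_right, hee]
    ring
  -- assemble: `‖k − s‖² = ‖k‖² − 2 re⟪s, k⟫ + re⟪s, s⟫`
  rw [← hLHS, norm_sub_sq (𝕜 := 𝕜), inner_re_symm, hk2, hsk, norm_sq_eq_re_inner (𝕜 := 𝕜), hss]

/-- RH-FREE. **(S4) with Hilbert-space data.**  In the situation of `opNorm_sub_finRankOp_le`
(`A` with kernel `D`, `p_i ∈ L²` with bounded measurable representatives `F_i`):
`∫∫ ‖D(x, y) − Σ t_ij F_i(x) conj F_j(y)‖² = ∫∫ ‖D‖² − 2 re Σ_ij conj(t_ij) ⟪p_i, A p_j⟫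
   + re Σ_ijkl conj(t_ij) t_kl ⟪p_i, p_k⟫ ⟪p_l, p_j⟫`
— the residual in terms of the "analytic inputs" `M_ij = ⟪p_i, A p_j⟫`, `H = ∫∫‖D‖²` and the Gram
matrix `gram p`. [cite: ConnesConsani2021, Lemma 6.3 §6.4 p. 24 and Fact 6.1 (residual of a finite-rank approximant, pattern)] -/
theorem integral_integral_norm_sub_finRank_sq_eq_inner {D : X → X → 𝕜} {C : ℝ}
    (hD : StronglyMeasurable (uncurry D)) (hC : ∀ x y, ‖D x y‖ ≤ C)
    (A : Lp 𝕜 2 μ →L[𝕜] Lp 𝕜 2 μ)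
    (hA : ∀ φ ψ : Lp 𝕜 2 μ, ⟪ψ, A φ⟫_𝕜 = ∫ x, conj (ψ x) * ∫ y, D x y * φ y ∂μ ∂μ)
    (p : ι → Lp 𝕜 2 μ) (F : ι → X → 𝕜) (hFm : ∀ i, Measurable (F i)) {B : ℝ}
    (hFb : ∀ i x, ‖F i x‖ ≤ B) (hp : ∀ i, (p i : X → 𝕜) =ᵐ[μ] F i) (t : Matrix ι ι 𝕜) :
    ∫ x, ∫ y, ‖D x y - ∑ i, ∑ j, t i j * (F i x * conj (F j y))‖ ^ 2 ∂μ ∂μ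
      = (∫ x, ∫ y, ‖D x y‖ ^ 2 ∂μ ∂μ)
        - 2 * RCLike.re (∑ i, ∑ j, conj (t i j) * ⟪p i, A (p j)⟫_𝕜)
        + RCLike.re (∑ i, ∑ j, ∑ k, ∑ l, conj (t i j) * t k l *
            (gram (𝕜 := 𝕜) p i k * gram (𝕜 := 𝕜) p l j)) := by
  have hM : ∀ i j, ⟪p i, A (p j)⟫_𝕜 = ∫ x, conj (F i x) * ∫ y, D x y * F j y ∂μ ∂μ := by
    intro i j
    rw [hA]
    refine integral_congr_ae ?_
    filter_upwards [hp i] with x hx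
    rw [hx]
    congr 1
    refine integral_congr_ae ?_
    filter_upwards [hp j] with y hy
    rw [hy]
  have hΓ : ∀ i k, gram (𝕜 := 𝕜) p i k = ∫ x, conj (F i x) * F k x ∂μ := by
    intro i k
    rw [gram_apply, L2.inner_def]
    refine integral_congr_ae ?_
    filter_upwards [hp i, hp k] with x h1 h2
    rw [RCLike.inner_apply', h1, h2]
  simp only [hM, hΓ]
  exact integral_integral_norm_sub_finRank_sq hD hC F hFm hFb t

end FiniteRankKernel

/-! ## The window instance: `𝓗 = L²([a, b])`, `K = windowOp κ`, Legendre family -/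

section Window

variable {κ : ℝ → ℂ} {a b : ℝ} {ι : Type*} [Fintype ι]

/-- `κ_S` is measurable for continuous `κ`. [folklore] -/
private theorem measurable_windowKernel (hκc : Continuous κ) : Measurable (windowKernel a b κ) :=
  hκc.measurable.indicator measurableSet_Icc

/-- The kernel `(y, x) ↦ κ_S(y − x)` is strongly measurable. [folklore] -/
private theorem stronglyMeasurable_windowKernel₂ (hκc : Continuous κ) :
    StronglyMeasurable (uncurry fun y x : ℝ ↦ windowKernel a b κ (y - x)) :=
  ((measurable_windowKernel hκc).comp (measurable_fst.sub measurable_snd)).stronglyMeasurable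

/-- A continuous `κ` is bounded on the window. [folklore] -/
private theorem exists_bound_windowKernel (hκc : Continuous κ) :
    ∃ C : ℝ, ∀ v, ‖windowKernel a b κ v‖ ≤ C := by
  obtain ⟨C, hC⟩ := (isCompact_Icc : IsCompact (Icc (a - b) (b - a))).exists_bound_of_continuousOn
    hκc.continuousOn
  refine ⟨max C 0, fun v ↦ ?_⟩
  by_cases hv : v ∈ Icc (a - b) (b - a)
  · rw [windowKernel, indicator_of_mem hv]
    exact (hC v hv).trans (le_max_left _ _)
  · rw [windowKernel, indicator_of_notMem hv, norm_zero]
    exact le_max_right _ _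

/-- Truncated continuous representatives `1_I F_i` are uniformly bounded (finite family). [folklore] -/
private theorem exists_bound_indicator (F : ι → ℝ → ℂ) (hF : ∀ i, Continuous (F i)) :
    ∃ B : ℝ, ∀ i x, ‖(Icc a b).indicator (F i) x‖ ≤ B := by
  have h : ∀ i, ∃ Bi : ℝ, ∀ x ∈ Icc a b, ‖F i x‖ ≤ Bi := fun i ↦
    isCompact_Icc.exists_bound_of_continuousOn (hF i).continuousOn
  choose Bf hBf using h
  refine ⟨∑ i, max (Bf i) 0, fun i x ↦ ?_⟩
  have hle : max (Bf i) 0 ≤ ∑ j, max (Bf j) 0 :=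
    Finset.single_le_sum (fun j _ ↦ le_max_right (Bf j) 0) (Finset.mem_univ i)
  by_cases hx : x ∈ Icc a b
  · rw [indicator_of_mem hx]
    exact ((hBf i x hx).trans (le_max_left _ _)).trans hle
  · rw [indicator_of_notMem hx, norm_zero]
    exact (le_max_right _ _).trans hle

/-- Two-fold `setIntegral_congr_fun` on `I × I`. [folklore] -/
private theorem setIntegral_setIntegral_congr {E' : Type*} [NormedAddCommGroup E'] [NormedSpace ℝ E']
    {f g : ℝ → ℝ → E'} (h : ∀ y ∈ Icc a b, ∀ x ∈ Icc a b, f y x = g y x) :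
    ∫ y in Icc a b, ∫ x in Icc a b, f y x = ∫ y in Icc a b, ∫ x in Icc a b, g y x :=
  setIntegral_congr_fun measurableSet_Icc fun y hy ↦
    setIntegral_congr_fun measurableSet_Icc fun x hx ↦ h y hy x hx

/-- RH-FREE. **(S1) for the window operator**: for continuous `κ`, vectors `p_i ∈ 𝓗 = L²([a, b])`
with continuous representatives `F_i` on `[a, b]`, and any complex matrix `t`,
`‖windowOp κ − Σ t_ij |p_i⟩⟨p_j|‖ ≤ (∫_I ∫_I ‖κ(y − x) − Σ_ij t_ij F_i(y) conj F_j(x)‖² dx dy)^{1/2}`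
(the Schwartz kernel `κ(y − x)` of `windowOp κ`, `inner_windowOp_eq_integral_integral`, minus the
finite-rank kernel; Cauchy–Schwarz).  The step `‖𝐊_I − T‖ ≤ ε₁` of the certificate with the
Hilbert–Schmidt norm in place of Lemma 6.3's `L¹` bound.
[cite: ConnesConsani2021, Lemma 6.3 §6.4 p. 24 (pattern); Thm. 3.6 §3 p. 13; Prop. 5.5 (ii) §5 p. 21] -/
theorem norm_windowOp_sub_finRankOp_le (hκ : IntegrableOn κ (Icc (a - b) (b - a)))
    (hκc : Continuous κ) (p : ι → Lp ℂ 2 (volume.restrict (Icc a b))) (F : ι → ℝ → ℂ)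
    (hF : ∀ i, Continuous (F i)) (hp : ∀ i, (p i : ℝ → ℂ) =ᵐ[volume.restrict (Icc a b)] F i)
    (t : Matrix ι ι ℂ) :
    ‖windowOp a b hκ - finRankOp p t‖
      ≤ Real.sqrt (∫ y in Icc a b, ∫ x in Icc a b,
          ‖κ (y - x) - ∑ i, ∑ j, t i j * (F i y * conj (F j x))‖ ^ 2) := by
  obtain ⟨C, hC⟩ := exists_bound_windowKernel (a := a) (b := b) hκc
  obtain ⟨B, hB⟩ := exists_bound_indicator (a := a) (b := b) F hF
  have hFtm : ∀ i, Measurable ((Icc a b).indicator (F i)) := fun i ↦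
    (hF i).measurable.indicator measurableSet_Icc
  have hpt : ∀ i, (p i : ℝ → ℂ) =ᵐ[volume.restrict (Icc a b)] (Icc a b).indicator (F i) := fun i ↦
    (hp i).trans ((ae_restrict_mem measurableSet_Icc).mono fun x hx ↦ (indicator_of_mem hx _).symm)
  have h := opNorm_sub_finRankOp_le (μ := volume.restrict (Icc a b))
    (D := fun y x ↦ windowKernel a b κ (y - x)) (stronglyMeasurable_windowKernel₂ hκc)
    (fun y x ↦ hC (y - x)) (windowOp a b hκ)
    (fun φ ψ ↦ inner_windowOp_eq_integral_integral hκ hκc φ ψ) p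
    (fun i ↦ (Icc a b).indicator (F i)) hFtm hB hpt t
  refine h.trans (le_of_eq ?_)
  congr 1
  refine setIntegral_setIntegral_congr fun y hy x hx ↦ ?_
  simp only [windowKernel_sub_of_mem hx hy, indicator_of_mem hx, indicator_of_mem hy]

/-- RH-FREE. **(S4) for the window operator**: with `H = ∫_I∫_I ‖κ(y − x)‖²`,
`M_ij = ⟪p_i, windowOp κ p_j⟫` and `Γ = gram p`,
`∫_I∫_I ‖κ(y−x) − Σ t_ij F_i(y) conj F_j(x)‖² = H − 2 re Σ_ij conj(t_ij) M_ij + re Σ_ijkl conj(t_ij) t_kl Γ_ik Γ_lj`.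
[cite: ConnesConsani2021, Lemma 6.3 §6.4 p. 24 and Fact 6.1 (residual of the finite-rank approximant, pattern)] -/
theorem hsResidual_windowOp_eq (hκ : IntegrableOn κ (Icc (a - b) (b - a)))
    (hκc : Continuous κ) (p : ι → Lp ℂ 2 (volume.restrict (Icc a b))) (F : ι → ℝ → ℂ)
    (hF : ∀ i, Continuous (F i)) (hp : ∀ i, (p i : ℝ → ℂ) =ᵐ[volume.restrict (Icc a b)] F i)
    (t : Matrix ι ι ℂ) :
    ∫ y in Icc a b, ∫ x in Icc a b, ‖κ (y - x) - ∑ i, ∑ j, t i j * (F i y * conj (F j x))‖ ^ 2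
      = (∫ y in Icc a b, ∫ x in Icc a b, ‖κ (y - x)‖ ^ 2)
        - 2 * (∑ i, ∑ j, conj (t i j) * ⟪p i, windowOp a b hκ (p j)⟫_ℂ).re
        + (∑ i, ∑ j, ∑ k, ∑ l, conj (t i j) * t k l *
            (gram (𝕜 := ℂ) p i k * gram (𝕜 := ℂ) p l j)).re := by
  obtain ⟨C, hC⟩ := exists_bound_windowKernel (a := a) (b := b) hκc
  obtain ⟨B, hB⟩ := exists_bound_indicator (a := a) (b := b) F hF
  have hFtm : ∀ i, Measurable ((Icc a b).indicator (F i)) := fun i ↦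
    (hF i).measurable.indicator measurableSet_Icc
  have hpt : ∀ i, (p i : ℝ → ℂ) =ᵐ[volume.restrict (Icc a b)] (Icc a b).indicator (F i) := fun i ↦
    (hp i).trans ((ae_restrict_mem measurableSet_Icc).mono fun x hx ↦ (indicator_of_mem hx _).symm)
  have h := integral_integral_norm_sub_finRank_sq_eq_inner (μ := volume.restrict (Icc a b))
    (D := fun y x ↦ windowKernel a b κ (y - x)) (stronglyMeasurable_windowKernel₂ hκc)
    (fun y x ↦ hC (y - x)) (windowOp a b hκ)
    (fun φ ψ ↦ inner_windowOp_eq_integral_integral hκ hκc φ ψ) p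
    (fun i ↦ (Icc a b).indicator (F i)) hFtm hB hpt t
  have e1 : ∫ y in Icc a b, ∫ x in Icc a b,
      ‖windowKernel a b κ (y - x) - ∑ i, ∑ j, t i j *
        ((Icc a b).indicator (F i) y * conj ((Icc a b).indicator (F j) x))‖ ^ 2
      = ∫ y in Icc a b, ∫ x in Icc a b, ‖κ (y - x) - ∑ i, ∑ j, t i j * (F i y * conj (F j x))‖ ^ 2 :=
    setIntegral_setIntegral_congr fun y hy x hx ↦ by
      simp only [windowKernel_sub_of_mem hx hy, indicator_of_mem hx, indicator_of_mem hy]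
  have e2 : ∫ y in Icc a b, ∫ x in Icc a b, ‖windowKernel a b κ (y - x)‖ ^ 2
      = ∫ y in Icc a b, ∫ x in Icc a b, ‖κ (y - x)‖ ^ 2 :=
    setIntegral_setIntegral_congr fun y hy x hx ↦ by rw [windowKernel_sub_of_mem hx hy]
  rw [← e1, ← e2]
  exact h

/-! ### The Legendre window family: matrix coefficients and the assembled soundness theorem -/

/-- RH-FREE. **The analytic inputs `M_ij` as explicit integrals**: for the Legendre window vectors,
`⟪p_i, windowOp κ p_j⟫ = ∫_I p_i(y) (∫_I κ(y − x) p_j(x) dx) dy` (real polynomials: no conjugation).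
[cite: ConnesConsani2021, §6.4 p. 24 and Prop. 5.5 (ii) eq. (opkf) §5 p. 20 (matrix coefficients of `𝐊_I`, pattern)] -/
theorem inner_legendreWindowVec_windowOp (hκ : IntegrableOn κ (Icc (a - b) (b - a)))
    (hκc : Continuous κ) (i j : ℕ) :
    ⟪legendreWindowVec a b i, windowOp a b hκ (legendreWindowVec a b j)⟫_ℂ
      = ∫ y in Icc a b, legendreWindowFn a b i y *
          ∫ x in Icc a b, κ (y - x) * legendreWindowFn a b j x := by
  rw [inner_windowOp_eq_integral_integral hκ hκc]
  refine integral_congr_ae ?_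
  filter_upwards [coeFn_legendreWindowVec a b i, ae_restrict_mem measurableSet_Icc] with y hy hymem
  rw [hy, conj_legendreWindowFn]
  congr 1
  refine integral_congr_ae ?_
  filter_upwards [coeFn_legendreWindowVec a b j, ae_restrict_mem measurableSet_Icc] with x hx hxmem
  rw [hx, windowKernel_sub_of_mem hxmem hymem]

/-- RH-FREE. `gram` of the Legendre window family, entrywise: `⟪p_i, p_k⟫ = δ_ik (b − a)/(2i + 1)`.
[cite: ConnesConsani2021, §6.5 p. 25 (pattern); AndrewsAskeyRoy1999 (2.5.14)] -/
theorem gram_legendreWindowFamily_apply (hab : a < b) (N : ℕ) (i k : Fin (N + 1)) :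
    gram (𝕜 := ℂ) (legendreWindowFamily a b N) i k
      = if i = k then (((b - a) / (2 * (i : ℕ) + 1) : ℝ) : ℂ) else 0 := by
  rw [gram_legendreWindowFamily hab N, Matrix.map_apply, legendreGram, Matrix.diagonal_apply]
  split_ifs <;> simp

/-- RH-FREE. **(S4) for the Legendre window family and real coefficients** (diagonal Gram matrix):
`∫_I∫_I ‖κ(y−x) − Σ t_ij p_i(y) p_j(x)‖² = H − 2 Σ_ij t_ij re M_ij + Σ_ij t_ij² (b−a)/(2i+1) · (b−a)/(2j+1)`,
`H = ∫_I∫_I‖κ(y − x)‖²`, `M_ij = ⟪p_i, windowOp κ p_j⟫` (`inner_legendreWindowVec_windowOp`).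
[cite: ConnesConsani2021, Lemma 6.3 §6.4 p. 24 and Fact 6.1 (residual `ε₁`, pattern)] -/
theorem hsResidual_legendre_eq (hab : a < b) (hκ : IntegrableOn κ (Icc (a - b) (b - a)))
    (hκc : Continuous κ) (N : ℕ) (t : Matrix (Fin (N + 1)) (Fin (N + 1)) ℝ) :
    ∫ y in Icc a b, ∫ x in Icc a b, ‖κ (y - x) - ∑ i, ∑ j,
        (t i j : ℂ) * (legendreWindowFn a b i y * legendreWindowFn a b j x)‖ ^ 2
      = (∫ y in Icc a b, ∫ x in Icc a b, ‖κ (y - x)‖ ^ 2)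
        - 2 * ∑ i : Fin (N + 1), ∑ j : Fin (N + 1), t i j *
            (⟪legendreWindowFamily a b N i, windowOp a b hκ (legendreWindowFamily a b N j)⟫_ℂ).re
        + ∑ i : Fin (N + 1), ∑ j : Fin (N + 1),
            t i j ^ 2 * (((b - a) / (2 * (i : ℕ) + 1)) * ((b - a) / (2 * (j : ℕ) + 1))) := by
  have h := hsResidual_windowOp_eq hκ hκc (legendreWindowFamily a b N)
    (fun i ↦ legendreWindowFn a b i) (fun i ↦ continuous_legendreWindowFn a b i)
    (fun i ↦ coeFn_legendreWindowVec a b i) (t.map ((↑) : ℝ → ℂ))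
  simp only [Matrix.map_apply, conj_legendreWindowFn, Complex.conj_ofReal] at h
  have e3 : (∑ i : Fin (N + 1), ∑ j : Fin (N + 1), (t i j : ℂ) *
      ⟪legendreWindowFamily a b N i, windowOp a b hκ (legendreWindowFamily a b N j)⟫_ℂ).re
      = ∑ i : Fin (N + 1), ∑ j : Fin (N + 1), t i j *
          (⟪legendreWindowFamily a b N i, windowOp a b hκ (legendreWindowFamily a b N j)⟫_ℂ).re := by
    simp only [Complex.re_sum, Complex.re_ofReal_mul]
  have e4 : (∑ i : Fin (N + 1), ∑ j : Fin (N + 1), ∑ k : Fin (N + 1), ∑ l : Fin (N + 1),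
      (t i j : ℂ) * (t k l : ℂ) *
        (gram (𝕜 := ℂ) (legendreWindowFamily a b N) i k * gram (𝕜 := ℂ) (legendreWindowFamily a b N) l j)).re
      = ∑ i : Fin (N + 1), ∑ j : Fin (N + 1),
          t i j ^ 2 * (((b - a) / (2 * (i : ℕ) + 1)) * ((b - a) / (2 * (j : ℕ) + 1))) := by
    rw [Complex.re_sum]
    refine Finset.sum_congr rfl fun i _ ↦ ?_
    rw [Complex.re_sum]
    refine Finset.sum_congr rfl fun j _ ↦ ?_
    simp only [gram_legendreWindowFamily_apply hab, mul_ite, ite_mul, mul_zero, zero_mul,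
      Finset.sum_ite_eq, Finset.sum_ite_eq', Finset.mem_univ, if_true]
    simp only [← Complex.ofReal_mul, Complex.ofReal_re]
    ring
  rw [h, e3, e4]

/-- RH-FREE. **Soundness of the Legendre–Galerkin spectral certificate** (assembly of (S1)–(S4) with
part 1's (S2) `opIneq_of_compression_gap`, `gap_of_real_certificate` and (S3)).  Let `κ` be
continuous, `N ∈ ℕ`, `t` a real `(N+1) × (N+1)` matrix, and `a₀, μ, δ` real with `0 ≤ δ ≤ 1`,
`δ ≤ μ`.  If
* (PSD certificate) `certQuadForm (legendreGram (b − a) N) t (constCoords (b − a) N) a₀ μ x ≥ 0` for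
  every real vector `x`, and
* (residual) `∫_I∫_I ‖κ(y − x) − Σ_ij t_ij p_i(y) p_j(x)‖² dx dy ≤ δ²` for the rescaled Legendre
  polynomials `p_i = legendreWindowFn a b i`,
then `0 ≤ re⟪ξ, ξ − windowOp κ ξ⟫ + a₀ ‖⟪constVector a b, ξ⟫‖²` for every `ξ ∈ L²([a, b])`.  With
`κ = ϖ_G`, `[a, b] = [−½ log 2, ½ log 2]` this is verbatim the hypothesis `hpos` of
`MainInequalityAssembly.weilArchPositivity_soninTrace_fine_of_opIneq`; the two displayed hypotheses
are what the kernel-checked certificate (row C-CHECK) establishes from rational data and enclosures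
of `M_ij`, `H` (`hsResidual_legendre_eq`).  Pattern of Lemma 6.10's deduction of the operator
inequality from finite-rank spectral data and `‖𝐊_I − T‖ ≤ ε₁`.
[cite: ConnesConsani2021, Lemma 6.10 §6.7 p. 28 and Lemma 6.3 §6.4 p. 24 (proof pattern)] -/
theorem targetIneq_of_legendreCertificate (hab : a < b) (hκ : IntegrableOn κ (Icc (a - b) (b - a)))
    (hκc : Continuous κ) (N : ℕ) (t : Matrix (Fin (N + 1)) (Fin (N + 1)) ℝ) {a₀ μ δ : ℝ}
    (hq : ∀ x : Fin (N + 1) → ℝ,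
      0 ≤ certQuadForm (legendreGram (b - a) N) t (constCoords (b - a) N) a₀ μ x)
    (hres : ∫ y in Icc a b, ∫ x in Icc a b, ‖κ (y - x) - ∑ i, ∑ j,
        (t i j : ℂ) * (legendreWindowFn a b i y * legendreWindowFn a b j x)‖ ^ 2 ≤ δ ^ 2)
    (hδ0 : 0 ≤ δ) (hδ1 : δ ≤ 1) (hδμ : δ ≤ μ) (ξ : Lp ℂ 2 (volume.restrict (Icc a b))) :
    0 ≤ RCLike.re ⟪ξ, ξ - windowOp a b hκ ξ⟫_ℂ + a₀ * ‖⟪constVector a b, ξ⟫_ℂ‖ ^ 2 := by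
  set p := legendreWindowFamily a b N with hpdef
  set V : Submodule ℂ (Lp ℂ 2 (volume.restrict (Icc a b))) := Submodule.span ℂ (Set.range p)
    with hV
  haveI : FiniteDimensional ℂ V := FiniteDimensional.span_of_finite ℂ (Set.finite_range p)
  haveI : CompleteSpace V := FiniteDimensional.complete ℂ V
  have hpV : ∀ i, p i ∈ V := fun i ↦ Submodule.subset_span ⟨i, rfl⟩
  have hφ₀ : constVector a b ∈ V := constVector_mem_span N
  refine opIneq_of_compression_gap V hφ₀ (K := windowOp a b hκ)
    (T := finRankOp p (t.map ((↑) : ℝ → ℂ)))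
    (fun ξ ↦ finRankOp_apply_eq_starProjection p hpV _ ξ) (fun ξ ↦ finRankOp_mem p hpV _ ξ)
    (fun v hv ↦ ?_) ?_ hδ1 hδμ ξ
  · have h := gap_of_real_certificate p (legendreGram (b - a) N) t (constCoords (b - a) N)
      (gram_legendreWindowFamily hab N) hq v hv
    rwa [← constVector_eq_sum_legendreWindowFamily a b N] at h
  · have h := norm_windowOp_sub_finRankOp_le hκ hκc p (fun i ↦ legendreWindowFn a b i)
      (fun i ↦ continuous_legendreWindowFn a b i) (fun i ↦ coeFn_legendreWindowVec a b i)
      (t.map ((↑) : ℝ → ℂ))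
    simp only [Matrix.map_apply, conj_legendreWindowFn] at h
    exact h.trans ((Real.sqrt_le_sqrt hres).trans (le_of_eq (Real.sqrt_sq hδ0)))

end Window

/-! ## The analytic input `H` as a single integral; symmetry of `M` -/

section WindowHS

variable {a b : ℝ} {κ : ℝ → ℂ}

/-- `∫_{[a,b]} f = ∫_a^b f` for `a ≤ b` (Lebesgue measure, no atoms). [folklore] -/
private theorem setIntegral_Icc_eq_intervalIntegral (hab : a ≤ b) (f : ℝ → ℝ) :
    ∫ x in Icc a b, f x = ∫ x in a..b, f x := by
  rw [intervalIntegral.integral_of_le hab, integral_Icc_eq_integral_Ioc]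

/-- RH-FREE. **The double integral of a difference kernel over a square as a single integral**:
for continuous `g` and `a ≤ b`,
`∫_{[a,b]} ∫_{[a,b]} g(y − x) dx dy = ∫_{[a−b, b−a]} ((b − a) − |v|) g(v) dv`
(the measure of `{(x, y) ∈ I × I : y − x = v}` is `(b − a) − |v|`; here by the fundamental theorem of
calculus and one integration by parts on each half of `[a − b, b − a]`).  This is the reduction of the
analytic input `H = ∫_I∫_I |ϖ(y − x)|²` of the certificate to `∫_{−L}^{L} (L − |v|) |ϖ(v)|² dv`,
`L = b − a`. [cite: ConnesConsani2021, Prop. 5.5 (ii) eq. (opkf) §5 p. 20 (the window `[a−b, b−a]` of the kernel form); Thm. 3.6 §3 p. 13 (square-integrability of the kernel)] -/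
theorem integral_Icc_integral_Icc_comp_sub (hab : a ≤ b) {g : ℝ → ℝ} (hg : Continuous g) :
    ∫ y in Icc a b, ∫ x in Icc a b, g (y - x)
      = ∫ v in Icc (a - b) (b - a), ((b - a) - |v|) * g v := by
  -- the primitive `Φ(s) = ∫_0^s g`
  set Φ : ℝ → ℝ := fun s ↦ ∫ v in (0 : ℝ)..s, g v with hΦ
  have hgi : ∀ p q : ℝ, IntervalIntegrable g volume p q := fun p q ↦ hg.intervalIntegrable p q
  have hΦd : ∀ s, HasDerivAt Φ (g s) s := fun s ↦ (hg.integral_hasStrictDerivAt 0 s).hasDerivAt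
  have hΦc : Continuous Φ := continuous_iff_continuousAt.2 fun s ↦ (hΦd s).continuousAt
  have hΦ0 : Φ 0 = 0 := intervalIntegral.integral_same
  have hΦi : ∀ c p q : ℝ, IntervalIntegrable (fun y ↦ Φ (y - c)) volume p q := fun c p q ↦
    (hΦc.comp (continuous_sub_right c)).intervalIntegrable p q
  -- the inner integral: `∫_{[a,b]} g(y − x) dx = Φ(y − a) − Φ(y − b)`
  have hinner : ∀ y, ∫ x in Icc a b, g (y - x) = Φ (y - a) - Φ (y - b) := by
    intro y
    rw [setIntegral_Icc_eq_intervalIntegral hab, intervalIntegral.integral_comp_sub_left (fun v ↦ g v) y]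
    exact (intervalIntegral.integral_interval_sub_left (hgi _ _) (hgi _ _)).symm
  -- the outer integral
  have hL : ∫ y in Icc a b, ∫ x in Icc a b, g (y - x)
      = (∫ u in (0 : ℝ)..(b - a), Φ u) - ∫ u in (a - b)..0, Φ u := by
    simp_rw [hinner]
    rw [setIntegral_Icc_eq_intervalIntegral hab, intervalIntegral.integral_sub (hΦi a _ _) (hΦi b _ _),
      intervalIntegral.integral_comp_sub_right (fun u ↦ Φ u) a,
      intervalIntegral.integral_comp_sub_right (fun u ↦ Φ u) b, sub_self, sub_self]
  -- the right-hand side on `[0, b − a]`: by parts with `u = (b − a) − v`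
  have hR1 : ∫ v in (0 : ℝ)..(b - a), ((b - a) - |v|) * g v = ∫ u in (0 : ℝ)..(b - a), Φ u := by
    have e : EqOn (fun v ↦ ((b - a) - |v|) * g v) (fun v ↦ ((b - a) - v) * g v) (uIcc 0 (b - a)) := by
      intro v hv
      rw [uIcc_of_le (sub_nonneg.2 hab)] at hv
      simp only [abs_of_nonneg hv.1]
    rw [intervalIntegral.integral_congr e]
    have h := intervalIntegral.integral_mul_deriv_eq_deriv_mul (a := 0) (b := b - a)
      (u := fun v ↦ (b - a) - v) (u' := fun _ ↦ -1) (v := Φ) (v' := g)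
      (fun v _ ↦ (hasDerivAt_id' v).const_sub (b - a)) (fun v _ ↦ hΦd v)
      (continuous_const.intervalIntegrable _ _) (hgi _ _)
    rw [h, hΦ0, sub_self]
    simp only [zero_mul, mul_zero, sub_zero, neg_mul, one_mul, intervalIntegral.integral_neg,
      sub_neg_eq_add, zero_add]
  -- the right-hand side on `[a − b, 0]`: by parts with `u = (b − a) + v`
  have hR2 : ∫ v in (a - b)..0, ((b - a) - |v|) * g v = -∫ u in (a - b)..0, Φ u := by
    have e : EqOn (fun v ↦ ((b - a) - |v|) * g v) (fun v ↦ ((b - a) + v) * g v) (uIcc (a - b) 0) := by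
      intro v hv
      rw [uIcc_of_le (by linarith : a - b ≤ 0)] at hv
      simp only [abs_of_nonpos hv.2, sub_neg_eq_add]
    rw [intervalIntegral.integral_congr e]
    have h := intervalIntegral.integral_mul_deriv_eq_deriv_mul (a := a - b) (b := 0)
      (u := fun v ↦ (b - a) + v) (u' := fun _ ↦ 1) (v := Φ) (v' := g)
      (fun v _ ↦ (hasDerivAt_id' v).const_add (b - a)) (fun v _ ↦ hΦd v)
      (continuous_const.intervalIntegrable _ _) (hgi _ _)
    rw [h, hΦ0]
    simp only [mul_zero, one_mul, zero_sub, show (b - a) + (a - b) = 0 by ring, zero_mul, sub_zero]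
  -- assemble
  have hR : ∫ v in Icc (a - b) (b - a), ((b - a) - |v|) * g v
      = (∫ v in (a - b)..0, ((b - a) - |v|) * g v) + ∫ v in (0 : ℝ)..(b - a), ((b - a) - |v|) * g v := by
    have hci : ∀ p q : ℝ, IntervalIntegrable (fun v ↦ ((b - a) - |v|) * g v) volume p q := fun p q ↦
      ((continuous_const.sub continuous_abs).mul hg).intervalIntegrable p q
    rw [setIntegral_Icc_eq_intervalIntegral (by linarith),
      intervalIntegral.integral_add_adjacent_intervals (hci _ _) (hci _ _)]
  rw [hL, hR, hR1, hR2]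
  ring

/-- RH-FREE. **The analytic input `H` as a single integral**: for continuous `κ` and `a ≤ b`,
`∫_I ∫_I ‖κ(y − x)‖² dx dy = ∫_{a−b}^{b−a} ((b − a) − |v|) ‖κ(v)‖² dv` (for CC's window and `κ = ϖ`:
`H = ∫_{−log 2}^{log 2} (log 2 − |v|) ϖ(v)² dv`).
[cite: ConnesConsani2021, Prop. 5.5 (ii) eq. (opkf) §5 p. 20; Thm. 3.6 §3 p. 13] -/
theorem hsNormSq_windowKernel_eq (hab : a ≤ b) {κ : ℝ → ℂ} (hκc : Continuous κ) :
    ∫ y in Icc a b, ∫ x in Icc a b, ‖κ (y - x)‖ ^ 2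
      = ∫ v in Icc (a - b) (b - a), ((b - a) - |v|) * ‖κ v‖ ^ 2 :=
  integral_Icc_integral_Icc_comp_sub hab (g := fun v ↦ ‖κ v‖ ^ 2) (hκc.norm.pow 2)

/-- Fubini symmetry for the kernel form with an even kernel and continuous test functions:
`∫_I f(y) ∫_I κ(y − x) g(x) = ∫_I g(y) ∫_I κ(y − x) f(x)`. [folklore] -/
private theorem integral_mul_integral_comp_sub_symm {f g κ : ℝ → ℂ} (hf : Continuous f)
    (hg : Continuous g) (hκc : Continuous κ) (heven : ∀ v, κ (-v) = κ v) :
    ∫ y in Icc a b, f y * ∫ x in Icc a b, κ (y - x) * g x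
      = ∫ y in Icc a b, g y * ∫ x in Icc a b, κ (y - x) * f x := by
  have hcont : Continuous (uncurry fun y x : ℝ ↦ f y * (κ (y - x) * g x)) :=
    (hf.comp continuous_fst).mul ((hκc.comp (continuous_fst.sub continuous_snd)).mul
      (hg.comp continuous_snd))
  have hint : Integrable (uncurry fun y x : ℝ ↦ f y * (κ (y - x) * g x))
      ((volume.restrict (Icc a b)).prod (volume.restrict (Icc a b))) := by
    rw [Measure.prod_restrict]
    exact hcont.continuousOn.integrableOn_compact (isCompact_Icc.prod isCompact_Icc)
  calc ∫ y in Icc a b, f y * ∫ x in Icc a b, κ (y - x) * g x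
      = ∫ y in Icc a b, ∫ x in Icc a b, f y * (κ (y - x) * g x) := by
        refine integral_congr_ae (Eventually.of_forall fun y ↦ ?_)
        exact (integral_const_mul _ _).symm
    _ = ∫ x in Icc a b, ∫ y in Icc a b, f y * (κ (y - x) * g x) := integral_integral_swap hint
    _ = ∫ x in Icc a b, g x * ∫ y in Icc a b, κ (x - y) * f y := by
        refine integral_congr_ae (Eventually.of_forall fun x ↦ ?_)
        dsimp only
        rw [← integral_const_mul]
        refine integral_congr_ae (Eventually.of_forall fun y ↦ ?_)
        dsimp only
        rw [← heven (x - y), neg_sub]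
        ring

/-- RH-FREE. **Symmetry of the analytic inputs**: for an EVEN continuous kernel (`κ(−v) = κ(v)`, e.g.
`ϖ_G`, `JumpFormula.varpi_neg`) the matrix `M_ij = ⟪p_i, windowOp κ p_j⟫` of the (real) Legendre
window family is symmetric, `M_ij = M_ji` — so only the entries `i ≤ j` need to be enclosed.  (No
realness of `κ` is needed; for Hermitian `κ` compare `KernelApproximation.inner_windowOp_symm`.)
[cite: ConnesConsani2021, §6.7 p. 28 ("both `T` and `𝐊_I` are self-adjoint", pattern); Prop. 5.5 (ii) §5 p. 20] -/
theorem inner_legendreWindowVec_windowOp_symm (hκ : IntegrableOn κ (Icc (a - b) (b - a)))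
    (hκc : Continuous κ) (heven : ∀ v, κ (-v) = κ v) (i j : ℕ) :
    ⟪legendreWindowVec a b i, windowOp a b hκ (legendreWindowVec a b j)⟫_ℂ
      = ⟪legendreWindowVec a b j, windowOp a b hκ (legendreWindowVec a b i)⟫_ℂ := by
  rw [inner_legendreWindowVec_windowOp hκ hκc, inner_legendreWindowVec_windowOp hκ hκc]
  exact integral_mul_integral_comp_sub_symm (continuous_legendreWindowFn a b i)
    (continuous_legendreWindowFn a b j) hκc heven

end WindowHS

end SpectralCert

end Literature.NumberTheory.ConnesConsani2021

end
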